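import Summits.ABC.StewartYu.PadicG3ExpLineP
import HarnessLib

/-!
# Cell abc-stewartyu, crux `Y07Odd` (stmt-ABC-19658), line `gen3-slab-odd`: the smallness exponent in the `exp(−U)`
# form (`‖Λ/b_{j₀}‖ ≤ exp(−U)`, `U` real) consumed by p3-g7's V-branch lines (`PadicG3VbLinesK.kstep_line_Vb`,
# `PadicG3VbHalf`)

`Summits/ABC/StewartYu/PadicG3ExpLineE.lean` — cell `abc-stewartyu` (seat p2-g4, F-odd lead).  Theorems only, no named fact;
corollaries of `PadicG3ExpLineP.expLine_V` / `expLine_V_gen` / `expLine_one_gen` via `(p^E)⁻¹ = exp(−E·log p)`.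

References: K. Yu, Acta Math. 211 (2013) §7.
-/

noncomputable section

open Finset

namespace Summit.ABC.StewartYu

namespace G3Setup

variable {p : ℕ} [Fact p.Prime] (S : G3Setup p)

omit [Fact p.Prime] S in
/-- `(p^E)⁻¹ = exp(−E·log p)` for a prime (indeed any positive) `p`. [folklore] -/
theorem inv_pow_eq_exp_neg (hp : 0 < (p : ℝ)) (E : ℕ) : ((p : ℝ) ^ E)⁻¹ = Real.exp (-((E : ℝ) * Real.log p)) := by
  rw [Real.exp_neg, Real.exp_nat_mul, Real.exp_log hp]

/-- **Smallness in the `exp(−U)` form, branch `m = 0`**: a real `U` with `‖Λ/b_{j₀}‖_p ≤ exp(−U)` and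
`8·2ⁿ·Zp + CondFloorV n ≤ U` — literally the hypotheses `hΛU`/`hU` of p3-g7's `kstep_line_Vb`. [cite: Yu2013, §7; shape only] -/
theorem expLine_V_exp (hn2 : 2 ≤ S.n) (V : Fin S.n → ℝ) (Vmax W : ℝ)
    (hV1 : ∀ j, 1 ≤ V j) (hWb : ∀ j, Real.log (max 3 (|S.b j| : ℝ)) ≤ W)
    (hU : ¬ (padicValRat p (∏ j, S.α j ^ S.b j - 1) : ℝ) * Real.log p ≤
        ((2 : ℝ) ^ 100) ^ S.n * ((p : ℝ) / Real.log p) * (∏ j, V j) * (W + Real.log p + Real.log (2 * Vmax)))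
    (P : PadicG3Par S.n) (hPp : P.p = p) (hPA : P.A = V) (hAmaxV : P.Amax ≤ Vmax)
    (hAmaxPr : P.Amax ≤ 2 ^ S.n * ∏ j, V j) (hPW : P.W = W) (hNq : P.Nq = P.K) (hK₀ : P.K₀ = p - 1)
    (hθ : P.θ₀ = 1 / 2) (hm : P.m = 0) :
    ∃ U : ℝ, ‖S.Λ / (S.b S.j₀ : ℚ_[p])‖ ≤ Real.exp (-U) ∧ 8 * 2 ^ S.n * P.Zp + P.CondFloorV S.n ≤ U := by
  have hp : p.Prime := Fact.out
  have hp0 : (0 : ℝ) < p := by exact_mod_cast hp.pos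
  obtain ⟨E, _, hΛ, hBE, _⟩ := S.expLine_V hn2 V Vmax W hV1 hWb hU P hPp hPA hAmaxV hAmaxPr hPW hNq hK₀ hθ hm
  refine ⟨(E : ℝ) * Real.log p, ?_, hBE⟩
  rwa [inv_pow_eq_exp_neg hp0] at hΛ

/-- **Smallness in the `exp(−U)` form, branch `m = 0`, scaled budget** `k·(8·2ⁿ·Zp + CondFloorV n) ≤ U`, `1 ≤ k ≤ 31/16`.
[cite: Yu2013, §7; shape only] -/
theorem expLine_V_exp_gen (hn2 : 2 ≤ S.n) (V : Fin S.n → ℝ) (Vmax W : ℝ)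
    (hV1 : ∀ j, 1 ≤ V j) (hWb : ∀ j, Real.log (max 3 (|S.b j| : ℝ)) ≤ W)
    (hU : ¬ (padicValRat p (∏ j, S.α j ^ S.b j - 1) : ℝ) * Real.log p ≤
        ((2 : ℝ) ^ 100) ^ S.n * ((p : ℝ) / Real.log p) * (∏ j, V j) * (W + Real.log p + Real.log (2 * Vmax)))
    (P : PadicG3Par S.n) (hPp : P.p = p) (hPA : P.A = V) (hAmaxV : P.Amax ≤ Vmax)
    (hAmaxPr : P.Amax ≤ 2 ^ S.n * ∏ j, V j) (hPW : P.W = W) (hNq : P.Nq = P.K) (hK₀ : P.K₀ = p - 1)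
    (hθ : P.θ₀ = 1 / 2) (hm : P.m = 0) {k : ℝ} (hk1 : 1 ≤ k) (hk : k ≤ 31 / 16) :
    ∃ U : ℝ, ‖S.Λ / (S.b S.j₀ : ℚ_[p])‖ ≤ Real.exp (-U) ∧ k * (8 * 2 ^ S.n * P.Zp + P.CondFloorV S.n) ≤ U := by
  have hp : p.Prime := Fact.out
  have hp0 : (0 : ℝ) < p := by exact_mod_cast hp.pos
  obtain ⟨E, _, hΛ, hBE, _⟩ :=
    S.expLine_V_gen hn2 V Vmax W hV1 hWb hU P hPp hPA hAmaxV hAmaxPr hPW hNq hK₀ hθ hm hk1 hk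
  refine ⟨(E : ℝ) * Real.log p, ?_, hBE⟩
  rwa [inv_pow_eq_exp_neg hp0] at hΛ

/-- **Smallness in the `exp(−U)` form, branch `m ≥ 1`**: `‖Λ/b_{j₀}‖ ≤ exp(−U)`, `k·2ⁿ·(G·X·L) ≤ U` for any `1 ≤ k ≤ 14`.
[cite: Yu2013, §7; shape only] -/
theorem expLine_one_exp_gen (hn2 : 2 ≤ S.n) (V : Fin S.n → ℝ) (Vmax W : ℝ)
    (hV1 : ∀ j, 1 ≤ V j) (hWb : ∀ j, Real.log (max 3 (|S.b j| : ℝ)) ≤ W)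
    (hU : ¬ (padicValRat p (∏ j, S.α j ^ S.b j - 1) : ℝ) * Real.log p ≤
        ((2 : ℝ) ^ 100) ^ S.n * ((p : ℝ) / Real.log p) * (∏ j, V j) * (W + Real.log p + Real.log (2 * Vmax)))
    (P : PadicG3Par S.n) (hPp : P.p = p) (hPA : P.A = V) (hAmaxV : P.Amax ≤ Vmax)
    (hAmaxPr : P.Amax ≤ 2 ^ S.n * ∏ j, V j) (hPW : P.W = W) (hNq : P.Nq = P.K) (hθ : P.θ₀ = 1 / 2) (hm : 1 ≤ P.m)
    {k : ℝ} (hk1 : 1 ≤ k) (hk : k ≤ 14) :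
    ∃ U : ℝ, ‖S.Λ / (S.b S.j₀ : ℚ_[p])‖ ≤ Real.exp (-U) ∧ k * 2 ^ S.n * (P.G * P.X * P.L) ≤ U := by
  have hp : p.Prime := Fact.out
  have hp0 : (0 : ℝ) < p := by exact_mod_cast hp.pos
  obtain ⟨E, _, hΛ, hBE, _⟩ :=
    S.expLine_one_gen hn2 V Vmax W hV1 hWb hU P hPp hPA hAmaxV hAmaxPr hPW hNq hθ hm hk1 hk
  refine ⟨(E : ℝ) * Real.log p, ?_, hBE⟩
  rwa [inv_pow_eq_exp_neg hp0] at hΛ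

end G3Setup

end Summit.ABC.StewartYu

end
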